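import Mathlib
import Summits.ValiantsHypothesis.ValiantsHypothesis.Cruxes.NNLinearDegreeCofactorHard.Lines.xc_division
import Summits.ValiantsHypothesis.ValiantsHypothesis.Theorems.FifoMatchingXcMinkowskiMultiplesHard
import Literature.Barriers.PneNP.ExtendedFormulationMinkowskiFaces
import Literature.Computability.Complexity.RectangleCorruptionBound
import HarnessLib

/-!
# Crux workfile `entangled-lift` (filed slug; working title was `virtual-xc`) (val-idea-39 g0, lens «information-complexity / common-information bounds»)
# for stmt-ValiantsHypothesis-21181 `Theses.FifoMatching.NNDivisionHard`

TRANSFER of the crux of record.  The reduction of record (`nnDivisionHard_of_xcMinkowski`, p625002;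
`route_21181_of_corMinkowski'`, workfile `xc_division.lean`) DISCARDS the second half of the hypothesis of
21181: a small monotone circuit-with-one-division for `NN_n = (NN_n·h)/h` gives BOTH `xc(NFP_n + Newt h) ≤ 3·2^T`
AND `xc(Newt h) ≤ 3·2^T` (`hasEFOfSize_newtonPolytope_complexity h`).  Keeping the second bound, 21181 follows from
the strictly WEAKER polyhedral statement «`NFP_n` (resp. `COR(K_h)`) is not a formal Minkowski DIFFERENCE `R ⊖ Q`
of two polytopes that BOTH have small extended formulations» — i.e. a lower bound on the VIRTUAL EXTENSION
COMPLEXITY `vxc(P) = min{xc(Q) + xc(R) : P + Q = R}` of Hertrich–Loho (arXiv:2411.03006, §1 p. 3; Question 5.1,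
OPEN in print: «Can vxc(P) be (much) smaller than xc(P)?»).  Dictionary: monotone circuit with one division gate
(HY21 §6 normal form `f = g/h`) ↦ virtual extended formulation `Newt f = Newt g ⊖ Newt h`, so
`vxc(Newt f) ≤ 3·L₊(f·h) + 3·L₊(h)` («Theorem 35, virtual form»).

PROVED here (kernel, no sorry): `xcVirtualHard_of_xcMinkowski` (the new statement is weaker than the crux of
record), `nnDivisionHard_of_xcVirtual` (it still implies 21181 BY NAME), `corVirtualHard_of_corMinkowski`
(n-free form weaker than COR-MINKOWSKI), `transport_step_virtual` (one located-face transport step carries the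
passenger's OWN extended formulation along, same size — the only new ingredient the geometric transport needs).
ALSO PROVED (§4): `transport_geometric_virtual`, `xcVirtualTransport_holds : CorVirtualHard → XcVirtualHard` and
`route_21181_of_corVirtual' : CorVirtualHard → NNDivisionHard` (sorry-free: the crux of record may be replaced by
the virtual law with NO other open input); (§5) the lens-(b) lever `separable_collapse` / `entangled_collapse`; (§6) the two-matrix floor
`three_pow_le_of_budget` / `corPolytope_add_three_pow_le_of_budget` (rank₊ of the passenger gap matrix ≤ s ⇒ hitting number ≤ 2^s
⇒ `(r+1)·2^s ≥ 1.5^n`); (§7, rev 1.3 — VERDICT #5 price P1) the ENTANGLEMENT BUDGET in COR currency modulo ONE named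
value-level fact: `UDisjRectangleCorruptionAt` (Razborov 1992 rectangle corruption, measure form; PORT WANTED, used as a hypothesis),
`approxRank_of_corruption` (corruption ⇒ approximate rank₊, via the tree's PROVED `hyperplane_separation_bound`) and
`entangled_budget` (`(1−2ρ) − 2κρ ≤ r·(L₀+2ρ)·ε(h)`: an EF of `COR(K_h)+Q` with `2^{o(h)}` lift coordinates carries entangled
weight `ρ ≥ 1/(2(1+κ)) − o(1)` in some clique row)
(separable or lightly entangled lift sections of a virtual EF collapse to an (approximate) nonnegative
factorization of `S_P` with the same row factors).  OPEN: `CorVirtualHard`, `XcVirtualHard`, 21181, `NNNotVP`, the summit; VP ≠ VNP is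
NOT proved.
-/

set_option autoImplicit false
set_option linter.dupNamespace false

namespace Summit.ValiantsHypothesis.ValiantsHypothesis.Cruxes.NNDivisionHard.EntangledLift

open scoped NNReal Pointwise
open MvPolynomial
open Literature.Barriers.PneNP (HasEFOfSize)
open Literature.Combinatorics.Optimization (corPolytopeGraph)
open Literature.Computability.AlgebraicComplexity (complexity nestFreeMatchingPoly)
open Literature.Computability.AlgebraicComplexity.MonotoneCircuitEF (hasEFOfSize_newtonPolytope_complexity)
open Literature.Algebra.Polynomial.NewtonPolytope (newtonPolytope newtonPolytope_mul)
open Summit.ValiantsHypothesis.ValiantsHypothesis.Cruxes.NNLinearDegreeCofactorHard.XcDivision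
  (T newtR XcMinkowskiHard CorMinkowskiHard dot_le_of_mem_convexHull hasEFOfSize_face_add hasEFOfSize_image_add
    convexHull_range_inter_eq exists_fin_range_eq route_21181_of_xcMinkowski)

/-! ## §1 The virtual (two-sided) polyhedral form of the division crux -/

/-- **XC-VIRTUAL (NFP currency)**: for every `c`, eventually in `n`, for every cofactor `h ≠ 0` over `ℝ≥0`:
if `NFP_n + Newt(h)` has an extended formulation of size `3·T c n` then `Newt(h)` has NONE of that size —
i.e. `NFP_n` is not a Minkowski difference of two polytopes of extension complexity `≤ 3·2^((log₂ n + c)^c)`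
with a lattice-Newton subtrahend.  Strictly weaker than `XcMinkowskiHard` (`xcVirtualHard_of_xcMinkowski`). -/
def XcVirtualHard : Prop :=
  ∀ c : ℕ, ∃ n₀ : ℕ, ∀ n ≥ n₀, ∀ h : MvPolynomial (Fin (2 * n) × Fin (2 * n)) ℝ≥0, h ≠ 0 →
    HasEFOfSize (newtR (nestFreeMatchingPoly n ℝ≥0) + newtR h) (3 * T c n) →
      ¬ HasEFOfSize (newtR h) (3 * T c n)

/-- **COR-VIRTUAL — the n-free crux C⁺ (graph currency, route rate)**: for every `c`, eventually in `h`, for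
every finite point family `q` and every `r`: if BOTH `COR(K_h) + conv{q}` and `conv{q}` have extended
formulations of size `r` then `T c h < r`.  Equivalently `vxc(COR(K_h))` (Hertrich–Loho 2024) is
super-quasi-polynomial: the NEGATIVE answer to their Question 5.1 for the correlation / cut polytope, at the
route's rate.  Strictly weaker than `CorMinkowskiHard` (`corVirtualHard_of_corMinkowski`).  OPEN. -/
def CorVirtualHard : Prop :=
  ∀ c : ℕ, ∃ h₀ : ℕ, ∀ h ≥ h₀, ∀ (K : ℕ) (q : Fin (K + 1) → (Fin h × Fin h → ℝ)) (r : ℕ),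
    HasEFOfSize (corPolytopeGraph (⊤ : SimpleGraph (Fin h)) + convexHull ℝ (Set.range q)) r →
      HasEFOfSize (convexHull ℝ (Set.range q)) r → T c h < r

/-- **the virtual transport (TYPED; porter work)**: the K1 located-face chain carries BOTH extended formulations. -/
def XcVirtualTransport : Prop := CorVirtualHard → XcVirtualHard

/-! ## §2 PROVED: weaker than the crux of record, and still sufficient for 21181 BY NAME -/

/-- XC-MINKOWSKI ⇒ XC-VIRTUAL (drop the second hypothesis). -/
theorem xcVirtualHard_of_xcMinkowski (hX : XcMinkowskiHard) : XcVirtualHard := by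
  intro c
  obtain ⟨n₀, hn₀⟩ := hX c
  exact ⟨n₀, fun n hn h hh hsum _ => hn₀ n hn h hh hsum⟩

/-- COR-MINKOWSKI ⇒ COR-VIRTUAL (drop the second hypothesis). -/
theorem corVirtualHard_of_corMinkowski (hC : CorMinkowskiHard) : CorVirtualHard := by
  intro c
  obtain ⟨h₀, hh₀⟩ := hC c
  exact ⟨h₀, fun h hh K q r hsum _ => hh₀ h hh K q r hsum⟩

/-- ★ **FIRST LEMMA (PROVED): XC-VIRTUAL ⇒ stmt-ValiantsHypothesis-21181 `NNDivisionHard` BY NAME.**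
Both summands of `L₊(NN_n·h) + L₊(h) ≤ T` are charged: the first gives the EF of the Minkowski sum
(`Newt(NN_n·h) = NFP_n + Newt h` over `ℝ≥0`, HY21 Thm 35 in circuit form), the second the EF of the subtrahend. -/
theorem nnDivisionHard_of_xcVirtual (hV : XcVirtualHard) :
    Summit.ValiantsHypothesis.ValiantsHypothesis.Theses.FifoMatching.NNDivisionHard := by
  intro c
  obtain ⟨n₀, hn₀⟩ := hV c
  refine ⟨n₀, fun n hn h hh => ?_⟩
  by_contra hle
  push Not at hle
  -- both complexities are at most `T c n`
  have h1 : complexity (nestFreeMatchingPoly n ℝ≥0 * h) ≤ T c n := le_trans (Nat.le_add_right _ _) hle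
  have h2 : complexity h ≤ T c n := le_trans (Nat.le_add_left _ _) hle
  have hEF := hasEFOfSize_newtonPolytope_complexity (nestFreeMatchingPoly n ℝ≥0 * h)
  rw [map_mul, newtonPolytope_mul] at hEF
  have hEFh := hasEFOfSize_newtonPolytope_complexity h
  exact hn₀ n hn h hh (hEF.of_le (by omega)) (hEFh.of_le (by omega))

/-- the composition with the typed transport: COR-VIRTUAL + virtual transport ⇒ 21181 BY NAME. -/
theorem route_21181_of_corVirtual (hT : XcVirtualTransport) (hC : CorVirtualHard) :
    Summit.ValiantsHypothesis.ValiantsHypothesis.Theses.FifoMatching.NNDivisionHard :=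
  nnDivisionHard_of_xcVirtual (hT hC)

/-! ## §3 PROVED: one transport step carries the passenger's own extended formulation -/

/-- **ONE VIRTUAL TRANSPORT STEP.**  As `transport_step`, but the passenger's OWN extended formulation rides
along with the same size: faces (`HasEFOfSize.inter_eq`) and linear images (`HasEFOfSize.image_linearMap`) of
`conv{q}` keep its EF size, and the transported passenger is the SAME point family `q'` for both conclusions. -/
theorem transport_step_virtual {ι κ J : Type} [Fintype ι] [Fintype κ] [Fintype J] [Nonempty J]
    {P : Set (ι → ℝ)} (q : J → ι → ℝ) {r r' : ℕ} (h : HasEFOfSize (P + convexHull ℝ (Set.range q)) r)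
    (hq : HasEFOfSize (convexHull ℝ (Set.range q)) r')
    (w : ι → ℝ) (δ : ℝ) (hP : ∀ x ∈ P, w ⬝ᵥ x ≤ δ) (L : (ι → ℝ) →ₗ[ℝ] (κ → ℝ)) :
    ∃ (K : ℕ) (q' : Fin (K + 1) → κ → ℝ),
      HasEFOfSize (L '' (P ∩ {x | w ⬝ᵥ x = δ}) + convexHull ℝ (Set.range q')) r ∧
        HasEFOfSize (convexHull ℝ (Set.range q')) r' := by
  classical
  obtain ⟨j₀, -, hj₀⟩ :=
    Finset.exists_max_image Finset.univ (fun j => w ⬝ᵥ q j) Finset.univ_nonempty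
  have hle : ∀ j, w ⬝ᵥ q j ≤ w ⬝ᵥ q j₀ := fun j => hj₀ j (Finset.mem_univ _)
  have hQ : ∀ y ∈ convexHull ℝ (Set.range q), w ⬝ᵥ y ≤ w ⬝ᵥ q j₀ :=
    dot_le_of_mem_convexHull _ w _ (by rintro _ ⟨j, rfl⟩; exact hle j)
  have h2 := hasEFOfSize_image_add (hasEFOfSize_face_add h w δ _ hP hQ) L
  have h3 := (hq.inter_eq w (w ⬝ᵥ q j₀)).image_linearMap L
  rw [convexHull_range_inter_eq q w _ hle, LinearMap.image_convexHull, ← Set.range_comp] at h2 h3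
  haveI : Nonempty {j : J // w ⬝ᵥ q j = w ⬝ᵥ q j₀} := ⟨⟨j₀, rfl⟩⟩
  obtain ⟨K, q', hq'⟩ := exists_fin_range_eq (L ∘ fun j : {j : J // w ⬝ᵥ q j = w ⬝ᵥ q j₀} => q j.1)
  exact ⟨K, q', by rw [hq']; exact h2, by rw [hq']; exact h3⟩

/-- the passenger's EF also survives a bare linear image (Step 2 of the geometric transport). -/
theorem passenger_image {ι κ J : Type} [Fintype ι] [Fintype κ] (q : J → ι → ℝ) {r' : ℕ}
    (hq : HasEFOfSize (convexHull ℝ (Set.range q)) r') (L : (ι → ℝ) →ₗ[ℝ] (κ → ℝ)) :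
    HasEFOfSize (convexHull ℝ (Set.range (L ∘ q))) r' := by
  have h := hq.image_linearMap L
  rwa [LinearMap.image_convexHull, ← Set.range_comp] at h


/-! ## §4 PROVED: the virtual transport `CorVirtualHard → XcVirtualHard` (the K1 located-face chain of
`xc_division.lean` §7–§8 verbatim, with `transport_step_virtual` / `passenger_image` threading the passenger's EF) -/

open Summit.ValiantsHypothesis.ValiantsHypothesis.Cruxes.NNLinearDegreeCofactorHard.XcDivision
  (inter_forall_eq_inter_sum sum_dotProduct_le newt_inter_zeroSet_eq T_pow_four_le)
open Summit.ValiantsHypothesis.ValiantsHypothesis.Theorems.FifoMatching.QueueGridFace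
  (realOf suppPts newt QGV patternVec queueGridPP corMap corMap_image_queueGridPP newt_nonneg)
open Summit.ValiantsHypothesis.ValiantsHypothesis.Theorems.FifoMatching.GridCorShadow (queueGridZeroOnePoints_holds)
open Summit.ValiantsHypothesis.ValiantsHypothesis.Theorems.FifoMatching.MonomialCofactor (newt_eq_newtonPolytope)
open Literature.Combinatorics.Optimization (AboulkerEtAl2019_gridCorCliqueFace)
open Literature.Computability.MetaComplexity (gridGraph)
open Matrix Finset

/-- **THE GEOMETRIC TRANSPORT, VIRTUAL FORM (PROVED)**: as `transport_geometric`, additionally carrying an EF of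
`Newt(h)` of size `s'` to one of the transported passenger `conv{q}` of the same size. -/
theorem transport_geometric_virtual :
    ∃ c : ℝ, 0 < c ∧ ∃ t₀ : ℕ, ∀ (n r g : ℕ), 1 ≤ r → (r + 1) * (2 * r + 1) ≤ n → ∀ (hg : 2 * g ≤ r), t₀ ≤ g →
      ∀ (hh : MvPolynomial (Fin (2 * n) × Fin (2 * n)) ℝ≥0), hh ≠ 0 → ∀ s s' : ℕ,
        HasEFOfSize (newtR (nestFreeMatchingPoly n ℝ≥0) + newtR hh) s → HasEFOfSize (newtR hh) s' →
          ∃ h : ℕ, c * g ≤ h ∧ ∃ (K : ℕ) (q : Fin (K + 1) → (Fin h × Fin h → ℝ)),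
            HasEFOfSize (corPolytopeGraph (⊤ : SimpleGraph (Fin h)) + convexHull ℝ (Set.range q)) s ∧
              HasEFOfSize (convexHull ℝ (Set.range q)) s' := by
  classical
  obtain ⟨c, hc, t₀, hface⟩ := AboulkerEtAl2019_gridCorCliqueFace
  refine ⟨c, hc, t₀, fun n r g hr hn hg ht hh hh0 s s' hEF hEFh => ?_⟩
  -- Step 0: Newton polytopes as hulls of their support points
  have hEF' : HasEFOfSize (newt (nestFreeMatchingPoly n ℝ≥0) + newt hh) s := by
    rw [newt_eq_newtonPolytope, newt_eq_newtonPolytope]; exact hEF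
  haveI : Nonempty hh.support := (MvPolynomial.support_nonempty.2 hh0).coe_sort
  let q₀ : hh.support → (Fin (2 * n) × Fin (2 * n)) → ℝ := fun d => realOf d.1
  have hQ : newt hh = convexHull ℝ (Set.range q₀) := by
    unfold newt suppPts; rw [Set.image_eq_range]; rfl
  rw [hQ] at hEF'
  have hq₀ : HasEFOfSize (convexHull ℝ (Set.range q₀)) s' := by
    rw [← hQ, newt_eq_newtonPolytope]; exact hEFh
  -- Step 1: the A1 coordinate face, read out onto `PP_r`
  obtain ⟨Z, f, hA1⟩ := queueGridZeroOnePoints_holds r n hr hn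
  let w : (Fin (2 * n) × Fin (2 * n)) → ℝ := fun e => if e ∈ Z then (-1 : ℝ) else 0
  have hw : ∀ x : (Fin (2 * n) × Fin (2 * n)) → ℝ, w ⬝ᵥ x = -∑ e ∈ Z, x e := by
    intro x
    simp only [dotProduct, w, ite_mul, neg_one_mul, zero_mul]
    rw [Finset.sum_ite_mem, Finset.univ_inter, Finset.sum_neg_distrib]
  have hP : ∀ x ∈ newt (nestFreeMatchingPoly n ℝ≥0), w ⬝ᵥ x ≤ 0 := fun x hx => by
    rw [hw]; exact neg_nonpos.2 (Finset.sum_nonneg fun e _ => newt_nonneg _ x hx e)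
  let Lf : ((Fin (2 * n) × Fin (2 * n)) → ℝ) →ₗ[ℝ] ((QGV r × QGV r) × Bool × Bool → ℝ) :=
    LinearMap.funLeft ℝ ℝ f
  obtain ⟨K₁, q₁, h₁, hq₁⟩ := transport_step_virtual q₀ hEF' hq₀ w 0 hP Lf
  have hF : Lf '' (newt (nestFreeMatchingPoly n ℝ≥0) ∩ {x | w ⬝ᵥ x = 0}) = queueGridPP r := by
    rw [newt_inter_zeroSet_eq, LinearMap.image_convexHull]
    unfold queueGridPP
    congr 1
  rw [hF] at h₁
  -- Step 2: c1's coordinate-linear map onto `COR(G_g)`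
  have h₂ := hasEFOfSize_image_add h₁ (corMap r g hg)
  have hq₂ := passenger_image q₁ hq₁ (corMap r g hg)
  rw [corMap_image_queueGridPP, LinearMap.image_convexHull, ← Set.range_comp,
    ← Summit.ValiantsHypothesis.ValiantsHypothesis.Theorems.FifoMatching.QueueGridFace.corPolytopeGraph_eq] at h₂
  -- Step 3: AFHMS's face of `COR(G_g)` onto `COR(K_h)`, as ONE valid functional
  obtain ⟨h, hch, k, cv, δ, π, hvalid, hπ⟩ := hface g ht
  obtain ⟨K₃, q₃, h₃, hq₃⟩ := transport_step_virtual (⇑(corMap r g hg) ∘ q₁) h₂ hq₂ (fun e => ∑ i, cv i e)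
    (∑ i, δ i) (sum_dotProduct_le _ cv δ hvalid) π
  rw [← inter_forall_eq_inter_sum _ cv δ hvalid, hπ] at h₃
  exact ⟨h, hch, K₃, q₃, h₃, hq₃⟩

/-- ★ **THE VIRTUAL TRANSPORT IS A THEOREM**: `CorVirtualHard → XcVirtualHard`. -/
theorem xcVirtualTransport_holds : XcVirtualTransport := by
  intro hK c
  obtain ⟨cA, hcA, t₀, htrans⟩ := transport_geometric_virtual
  obtain ⟨h₀, hh₀⟩ := hK (4 ^ (c + 1) + c + 1)
  -- constants
  set cm : ℝ := min cA 1 with hcm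
  have hcm0 : 0 < cm := lt_min hcA one_pos
  have hcmA : cm ≤ cA := min_le_left _ _
  have hcm1 : cm ≤ 1 := min_le_right _ _
  obtain ⟨S₁, hS₁⟩ := exists_nat_ge ((20 / cm) ^ 2)
  obtain ⟨S₀, hS₀a, hS₀b, hS₀c, hS₀d⟩ :
      ∃ S₀ : ℕ, 4 * t₀ + 4 ≤ S₀ ∧ h₀ ^ 2 ≤ S₀ ∧ S₁ ≤ S₀ ∧ 16 ≤ S₀ :=
    ⟨4 * t₀ + 4 + h₀ ^ 2 + S₁ + 16, by omega, by omega, by omega, by omega⟩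
  refine ⟨S₀ ^ 2, fun n hn hh hh0 hEF hEFh => ?_⟩
  obtain ⟨s, hs⟩ : ∃ s, s = Nat.sqrt n := ⟨_, rfl⟩
  have hsS : S₀ ≤ s := by rw [hs]; exact Nat.le_sqrt'.2 hn
  have hss : s ^ 2 ≤ n := by rw [hs]; exact Nat.sqrt_le' n
  have hns : n < (s + 1) ^ 2 := by rw [hs]; exact Nat.lt_succ_sqrt' n
  obtain ⟨g, hg⟩ : ∃ g, g = s / 4 := ⟨_, rfl⟩
  have h4g : 4 * g ≤ s := by rw [hg]; exact Nat.mul_div_le s 4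
  have hg4 : s < 4 * (g + 1) := by rw [hg]; omega
  have hg1 : 1 ≤ g := by omega
  have hgt : t₀ ≤ g := by omega
  have hn' : (2 * g + 1) * (2 * (2 * g) + 1) ≤ n := by nlinarith [Nat.mul_le_mul h4g h4g]
  obtain ⟨h, hch, K, q, hEF', hq'⟩ :=
    htrans n (2 * g) g (by omega) hn' (le_refl _) hgt hh hh0 (3 * T c n) (3 * T c n) hEF hEFh
  -- `h` is large: `h ≥ √s + 1`
  have hsqrt_s : Real.sqrt s * Real.sqrt s = s := Real.mul_self_sqrt (Nat.cast_nonneg s)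
  have hreal : Real.sqrt s + 1 ≤ (h : ℝ) := by
    have hS₁s : ((20 / cm) ^ 2 : ℝ) ≤ s := le_trans hS₁ (by exact_mod_cast (show S₁ ≤ s by omega))
    have hsq : 20 / cm ≤ Real.sqrt s := by
      rw [show (20 / cm : ℝ) = Real.sqrt ((20 / cm) ^ 2) by rw [Real.sqrt_sq (by positivity)]]
      exact Real.sqrt_le_sqrt hS₁s
    have h20 : 20 ≤ cm * Real.sqrt s := by
      have := mul_le_mul_of_nonneg_left hsq hcm0.le
      rwa [show cm * (20 / cm) = 20 by field_simp] at this
    have hg_real : (s : ℝ) / 4 - 1 ≤ g := by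
      have : (s : ℝ) < 4 * ((g : ℝ) + 1) := by exact_mod_cast hg4
      linarith
    have h1 : cm * ((s : ℝ) / 4 - 1) ≤ h :=
      calc cm * ((s : ℝ) / 4 - 1) ≤ cm * g := mul_le_mul_of_nonneg_left hg_real hcm0.le
        _ ≤ cA * g := mul_le_mul_of_nonneg_right hcmA (Nat.cast_nonneg g)
        _ ≤ h := hch
    have h2 : 20 * Real.sqrt s ≤ cm * s := by
      have := mul_le_mul_of_nonneg_right h20 (Real.sqrt_nonneg s)
      rw [mul_assoc, hsqrt_s] at this
      exact this
    have hs1 : 1 ≤ Real.sqrt s := by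
      rw [show (1 : ℝ) = Real.sqrt 1 by simp]
      exact Real.sqrt_le_sqrt (by exact_mod_cast (show 1 ≤ s by omega))
    nlinarith
  -- consequences in ℕ: `h ≥ h₀` and `n < h⁴`
  have hh₀' : h₀ ≤ h := by
    have : (h₀ : ℝ) ≤ Real.sqrt s := by
      rw [show (h₀ : ℝ) = Real.sqrt ((h₀ : ℝ) ^ 2) by rw [Real.sqrt_sq (Nat.cast_nonneg _)]]
      exact Real.sqrt_le_sqrt (by exact_mod_cast (show h₀ ^ 2 ≤ s by omega))
    exact_mod_cast (by linarith : (h₀ : ℝ) ≤ h)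
  have hn4 : n < h ^ 4 := by
    have hs1 : s + 1 ≤ h ^ 2 := by
      have : (s : ℝ) + 1 ≤ (h : ℝ) ^ 2 := by nlinarith [Real.sqrt_nonneg s]
      exact_mod_cast this
    calc n < (s + 1) ^ 2 := hns
      _ ≤ (h ^ 2) ^ 2 := Nat.pow_le_pow_left hs1 2
      _ = h ^ 4 := by rw [← pow_mul]
  have hn0 : n ≠ 0 := by
    have : 16 ^ 2 ≤ s ^ 2 := Nat.pow_le_pow_left (by omega) 2
    omega
  have hT := T_pow_four_le (c := c) hn0 hn4
  have hlt := hh₀ h hh₀' K q (3 * T c n) hEF' hq'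
  have hT2 : 2 ≤ T c n := by
    show 2 ^ 1 ≤ 2 ^ _
    exact Nat.pow_le_pow_right (by norm_num)
      (Nat.one_le_pow _ _ (by
        have h256 : 16 ^ 2 ≤ S₀ ^ 2 := Nat.pow_le_pow_left hS₀d 2
        have := Nat.log_pos one_lt_two (show 2 ≤ n by omega)
        omega))
  have h8 : 8 * T c n ≤ (T c n) ^ 4 := by
    have : 2 ^ 3 ≤ (T c n) ^ 3 := Nat.pow_le_pow_left hT2 3
    calc 8 * T c n = 2 ^ 3 * T c n := by norm_num
      _ ≤ (T c n) ^ 3 * T c n := Nat.mul_le_mul_right _ this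
      _ = (T c n) ^ 4 := by ring
  omega

/-- ★★ **COR-VIRTUAL ⇒ stmt-ValiantsHypothesis-21181 BY NAME, unconditionally in everything else**: the crux of
record `CorMinkowskiHard` (all passengers) may be replaced by the strictly weaker `CorVirtualHard` (passengers of
small extension complexity only) — «vxc(COR(K_h)) is super-quasi-polynomial».  Implication from an OPEN
hypothesis; 21181 stays OPEN. -/
theorem route_21181_of_corVirtual' (hC : CorVirtualHard) :
    Summit.ValiantsHypothesis.ValiantsHypothesis.Theses.FifoMatching.NNDivisionHard :=
  route_21181_of_corVirtual xcVirtualTransport_holds hC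

/-! ## §5 PROVED — the lens-(b) lever: ENTANGLEMENT OF THE LIFT is the only resource of a virtual EF.
Yannakakis for virtual extended formulations, one direction: an EF of `R = P + Q` with `r` slack variables gives,
for every row `a` (valid direction) with Farkas multipliers `U(a,·) ≥ 0`, and every column `(b, j)` (vertex `b` of
`P`, vertex `j` of `Q`), slack vectors `v(b,j) ∈ ℝ^r_{≥0}` with `Σ_w U(a,w) v_w(b,j) = S_P(a,b) + S_Q(a,j)`; the
`x`-part of `v` is ADDITIVE in `(b, j)`, the lift part is not.  Write `v_w(b,j) = α_w(b) + β_w(j) + t_w(b,j)`.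
`separable_collapse`: `t = 0` ⇒ `S_P` has a nonnegative factorization with the SAME `r` row factors (so
`r ≥ rank₊ S_P = xc(P)`: a virtual EF with additively liftable sections saves NOTHING).  `entangled_collapse`: if
the entangled part has row-weight `Σ_w U(a,w)‖t_w‖_∞ ≤ ρ` then `S_P` is within `2ρ` entrywise of a nonneg-rank-`r`
matrix — for `P = COR(K_n)` (rows = clique directions, `S_P ⊇ UDISJ`) and `ρ < 1/8` this forces `r ≥ 2^{Ω(n)}` by
Razborov's corruption bound / approximate nonnegative rank of UDISJ (Kol–Moran–Shpilka–Yehudayoff 2014), and for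
uniform entanglement BP13 Thm 4.4 gives `2^{n/8(1+2ρ)}`.  Hence: every quasi-polynomial virtual EF of `COR(K_n)`
has sections entangled by `ρ ≥ Ω(n / polylog)` slack units in some clique row (the ENTANGLEMENT BUDGET). -/

/-- **SEPARABLE SECTIONS COLLAPSE A VIRTUAL FACTORIZATION (V1″, matrix form).**  If the augmented slack
`F(a,b) + G(a,j)` of a Minkowski sum (rows `a`, columns = pairs (vertex `b` of `P`, vertex `j` of `Q`); `F, G ≥ 0`
with a zero in every row) has a nonnegative factorization `Σ_w U(a,w)·v_w(b,j)` whose column factors are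
ADDITIVELY SEPARABLE, `v_w(b,j) = α_w(b) + β_w(j) ≥ 0`, then `F` itself has a nonnegative factorization with the
same row factors — so the number of factors is at least `rank₊ F`.  (Separable = the lift section over
`vert P + vert Q` is additive; any saving of a virtual extended formulation needs ENTANGLED sections.) -/
theorem separable_collapse {A B J W : Type} [Fintype W] [Fintype J] [Nonempty J]
    (F : A → B → ℝ) (G : A → J → ℝ) (U : A → W → ℝ) (α : W → B → ℝ) (β : W → J → ℝ)
    (hU : ∀ a w, 0 ≤ U a w) (hF0 : ∀ a, ∃ b, F a b = 0) (hG0 : ∀ a, ∃ j, G a j = 0)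
    (hv : ∀ w b j, 0 ≤ α w b + β w j)
    (hsum : ∀ a b j, ∑ w, U a w * (α w b + β w j) = F a b + G a j) :
    ∃ V : W → B → ℝ, (∀ w b, 0 ≤ V w b) ∧ ∀ a b, ∑ w, U a w * V w b = F a b := by
  classical
  -- β⋆_w = min_j β_w(j)
  let βs : W → ℝ := fun w => Finset.univ.inf' Finset.univ_nonempty (β w)
  have hβs_le : ∀ w j, βs w ≤ β w j := fun w j => Finset.inf'_le _ (Finset.mem_univ j)
  have hV : ∀ w b, 0 ≤ α w b + βs w := by
    intro w b
    obtain ⟨j, -, hj⟩ := Finset.exists_mem_eq_inf' Finset.univ_nonempty (β w)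
    show 0 ≤ α w b + Finset.univ.inf' Finset.univ_nonempty (β w)
    rw [hj]; exact hv w b j
  refine ⟨fun w b => α w b + βs w, hV, fun a b => ?_⟩
  obtain ⟨b₀, hb₀⟩ := hF0 a
  obtain ⟨j₀, hj₀⟩ := hG0 a
  -- at the doubly-tight column `(b₀, j₀)` every term of the factorization vanishes
  have hzero : ∀ w, U a w * (α w b₀ + β w j₀) = 0 := by
    have h0 : ∑ w, U a w * (α w b₀ + β w j₀) = 0 := by rw [hsum, hb₀, hj₀, add_zero]
    intro w
    exact (Finset.sum_eq_zero_iff_of_nonneg fun w _ => mul_nonneg (hU a w) (hv w b₀ j₀)).1 h0 w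
      (Finset.mem_univ w)
  -- hence on the support of row `a`, `β⋆_w = β_w(j₀)`
  have hterm : ∀ w, U a w * (α w b + βs w) = U a w * (α w b + β w j₀) := by
    intro w
    by_cases hUw : U a w = 0
    · rw [hUw, zero_mul, zero_mul]
    · congr 1
      have h1 := hβs_le w j₀
      have h2 := hV w b₀
      rcases mul_eq_zero.1 (hzero w) with h | h
      · exact absurd h hUw
      · linarith
  calc ∑ w, U a w * (α w b + βs w) = ∑ w, U a w * (α w b + β w j₀) := Finset.sum_congr rfl fun w _ => hterm w
    _ = F a b + G a j₀ := hsum a b j₀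
    _ = F a b := by rw [hj₀, add_zero]

/-- **ROBUST COLLAPSE (entanglement budget).**  Same setting as `separable_collapse`, but the column factors
carry an ENTANGLED part `t_w(b,j)` with `|t_w| ≤ ε_w` and total row-weight `Σ_w U(a,w) ε_w ≤ ρ` in every row.
Then `F` is within `2ρ` (entrywise) of a matrix of nonnegative rank `≤ |W|` with the same row factors. -/
theorem entangled_collapse {A B J W : Type} [Fintype W] [Fintype J] [Nonempty J]
    (F : A → B → ℝ) (G : A → J → ℝ) (U : A → W → ℝ) (α : W → B → ℝ) (β : W → J → ℝ)
    (t : W → B → J → ℝ) (ε : W → ℝ) (ρ : ℝ)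
    (hU : ∀ a w, 0 ≤ U a w) (hF0 : ∀ a, ∃ b, F a b = 0) (hG0 : ∀ a, ∃ j, G a j = 0)
    (hv : ∀ w b j, 0 ≤ α w b + β w j + t w b j) (ht : ∀ w b j, |t w b j| ≤ ε w)
    (hε : ∀ a, ∑ w, U a w * ε w ≤ ρ)
    (hsum : ∀ a b j, ∑ w, U a w * (α w b + β w j + t w b j) = F a b + G a j) :
    ∃ V : W → B → ℝ, (∀ w b, 0 ≤ V w b) ∧ ∀ a b, |∑ w, U a w * V w b - F a b| ≤ 2 * ρ := by
  classical
  -- shifted separable part `β'_w = β_w + ε_w` and its minimum `β⋆_w`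
  let β' : W → J → ℝ := fun w j => β w j + ε w
  let βs : W → ℝ := fun w => Finset.univ.inf' Finset.univ_nonempty (β' w)
  have hβs_le : ∀ w j, βs w ≤ β' w j := fun w j => Finset.inf'_le _ (Finset.mem_univ j)
  have hαβ' : ∀ w b j, 0 ≤ α w b + β' w j := by
    intro w b j
    have h1 := hv w b j
    have h2 := (abs_le.1 (ht w b j)).2
    show 0 ≤ α w b + (β w j + ε w)
    linarith
  have hV : ∀ w b, 0 ≤ α w b + βs w := by
    intro w b
    obtain ⟨j, -, hj⟩ := Finset.exists_mem_eq_inf' Finset.univ_nonempty (β' w)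
    show 0 ≤ α w b + Finset.univ.inf' Finset.univ_nonempty (β' w)
    rw [hj]; exact hαβ' w b j
  -- the separable sums `S(b,j) = Σ_w U(a,w)(α_w(b) + β'_w(j))` are within `[F+G, F+G+2ρ]`
  have hS : ∀ a b j, F a b + G a j ≤ ∑ w, U a w * (α w b + β' w j) ∧
      ∑ w, U a w * (α w b + β' w j) ≤ F a b + G a j + 2 * ρ := by
    intro a b j
    have hdecomp : ∑ w, U a w * (α w b + β' w j) =
        (∑ w, U a w * (α w b + β w j + t w b j)) + ∑ w, U a w * (ε w - t w b j) := by
      rw [← Finset.sum_add_distrib]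
      refine Finset.sum_congr rfl fun w _ => ?_
      show U a w * (α w b + (β w j + ε w)) = _
      ring
    have hlo : 0 ≤ ∑ w, U a w * (ε w - t w b j) :=
      Finset.sum_nonneg fun w _ => mul_nonneg (hU a w) (by have := (abs_le.1 (ht w b j)).2; linarith)
    have hhi : ∑ w, U a w * (ε w - t w b j) ≤ 2 * ρ := by
      calc ∑ w, U a w * (ε w - t w b j) ≤ ∑ w, U a w * (2 * ε w) :=
            Finset.sum_le_sum fun w _ => mul_le_mul_of_nonneg_left
              (by have := (abs_le.1 (ht w b j)).1; linarith) (hU a w)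
        _ = 2 * ∑ w, U a w * ε w := by rw [Finset.mul_sum]; exact Finset.sum_congr rfl fun w _ => by ring
        _ ≤ 2 * ρ := by linarith [hε a]
    rw [hdecomp, hsum]
    constructor <;> linarith
  refine ⟨fun w b => α w b + βs w, hV, fun a b => ?_⟩
  obtain ⟨b₀, hb₀⟩ := hF0 a
  obtain ⟨j₀, hj₀⟩ := hG0 a
  -- upper bound: β⋆ ≤ β'(j₀)
  have hup : ∑ w, U a w * (α w b + βs w) ≤ F a b + 2 * ρ := by
    calc ∑ w, U a w * (α w b + βs w) ≤ ∑ w, U a w * (α w b + β' w j₀) :=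
          Finset.sum_le_sum fun w _ => mul_le_mul_of_nonneg_left (by linarith [hβs_le w j₀]) (hU a w)
      _ ≤ F a b + G a j₀ + 2 * ρ := (hS a b j₀).2
      _ = F a b + 2 * ρ := by rw [hj₀, add_zero]
  -- lower bound: the defect `Σ_w U (β'(j₀) - β⋆)` is at most the doubly-tight separable sum `S(b₀,j₀) ≤ 2ρ`
  have hdef : ∑ w, U a w * (β' w j₀ - βs w) ≤ 2 * ρ := by
    calc ∑ w, U a w * (β' w j₀ - βs w) ≤ ∑ w, U a w * (α w b₀ + β' w j₀) :=
          Finset.sum_le_sum fun w _ => mul_le_mul_of_nonneg_left (by linarith [hV w b₀]) (hU a w)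
      _ ≤ F a b₀ + G a j₀ + 2 * ρ := (hS a b₀ j₀).2
      _ = 2 * ρ := by rw [hb₀, hj₀]; ring
  have hlow : F a b - 2 * ρ ≤ ∑ w, U a w * (α w b + βs w) := by
    have h1 := (hS a b j₀).1
    have hsplit : ∑ w, U a w * (α w b + βs w) =
        (∑ w, U a w * (α w b + β' w j₀)) - ∑ w, U a w * (β' w j₀ - βs w) := by
      rw [← Finset.sum_sub_distrib]
      exact Finset.sum_congr rfl fun w _ => by ring
    rw [hsplit, hj₀, add_zero] at *
    linarith
  exact abs_le.2 ⟨by linarith, by linarith⟩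

open Summit.ValiantsHypothesis.ValiantsHypothesis.Cruxes.NNLinearDegreeCofactorHard.XcDivision
  (three_pow_le_of_hits udPt udRow ud_data)
open Literature.Combinatorics.Optimization.FixedSizePsdRank (corPolytope)

/-! ## §6 PROVED — the TWO-MATRIX FLOOR (support level): a nonnegative factorization of the passenger GAP matrix with `s`
terms yields a hitting family of size `≤ 2^s` (rows grouped by the support pattern of their row factor; one tight passenger
vertex hits the whole group), so PROP A of record prices the virtual budget: `(r+1)·2^s ≥ 1.5^n` for every EF of size `r` of
`COR(n) + Q` whose passenger gap matrix has `rank₊ ≤ s` (in particular `s ≤ xc(Q) + 1`).  Beyond `s ≈ 0.58·n` support level is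
void (abstract pair `UDISJ ⊗ 𝟙ᵀ + 𝟙 ⊗ h(J − I)`: `O(h)` rectangle cover) and the value-level lever of §5 must take over. -/

/-- **TWO-MATRIX FLOOR (support level).**  In the setting of `three_pow_le_of_hits` (an EF of `P + Q` of size `r`,
UDISJ data on `P`, passenger points `q j ∈ Q`), suppose the passenger GAP matrix admits a nonnegative factorization
`X · Y` with `s` terms whose zeros detect maximisers (`hhit`) and which has a zero in every row (`hzero`).  Then the rows
group into `≤ 2^s` support patterns of `X`, one passenger vertex hits each group, and PROP A gives
`3^{|α|} ≤ 2^s · (r+1) · 2^{|α|}` — i.e. `(r+1)·2^{s} ≥ 1.5^{|α|}` for every «virtual» pair of budgets `(r, s)`. -/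
theorem three_pow_le_of_budget {ι α J : Type} [Fintype ι] [Fintype α] [DecidableEq α] [Fintype J]
    {r s : ℕ} {P Q : Set (ι → ℝ)} (h : HasEFOfSize (P + Q) r)
    (v : Finset α → ι → ℝ) (hv : ∀ b, v b ∈ P)
    (c : Finset α → ι → ℝ) (d : Finset α → ℝ) (hvalid : ∀ a, ∀ x ∈ P, c a ⬝ᵥ x ≤ d a)
    (hone : ∀ a b, c a ⬝ᵥ v b < d a → (a ∩ b).card ≠ 1)
    (hdisj : ∀ a b, Disjoint a b → c a ⬝ᵥ v b < d a)
    (q : J → ι → ℝ) (hq : ∀ j, q j ∈ Q)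
    (X : Finset α → Fin s → ℝ) (Y : Fin s → J → ℝ) (hX : ∀ a k, 0 ≤ X a k) (hY : ∀ k j, 0 ≤ Y k j)
    (hzero : ∀ a, ∃ j, ∑ k, X a k * Y k j = 0)
    (hhit : ∀ a j, ∑ k, X a k * Y k j = 0 → ∀ y ∈ Q, c a ⬝ᵥ y ≤ c a ⬝ᵥ q j) :
    3 ^ Fintype.card α ≤ 2 ^ s * (r + 1) * 2 ^ Fintype.card α := by
  classical
  -- support pattern of a row and a tight column for each row
  let pat : Finset α → Finset (Fin s) := fun a => Finset.univ.filter fun k => X a k ≠ 0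
  choose jz hjz using hzero
  -- one representative column per pattern
  have hne : Nonempty J := ⟨jz ∅⟩
  let q' : Finset (Fin s) → ι → ℝ := fun K =>
    if hK : ∃ a, pat a = K then q (jz (Classical.choose hK)) else q (jz ∅)
  have hq' : ∀ K, q' K ∈ Q := by
    intro K; simp only [q']; split_ifs <;> exact hq _
  have hhit' : ∀ a, ∃ K, ∀ y ∈ Q, c a ⬝ᵥ y ≤ c a ⬝ᵥ q' K := by
    intro a
    refine ⟨pat a, ?_⟩
    have hK : ∃ a', pat a' = pat a := ⟨a, rfl⟩
    have hq'eq : q' (pat a) = q (jz (Classical.choose hK)) := by simp only [q', dif_pos hK]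
    rw [hq'eq]
    set a₁ := Classical.choose hK with ha₁
    have hpat : pat a₁ = pat a := Classical.choose_spec hK
    apply hhit
    -- every term of row `a` at column `jz a₁` vanishes
    have hrow₁ : ∀ k, X a₁ k * Y k (jz a₁) = 0 := by
      have := (Finset.sum_eq_zero_iff_of_nonneg fun k _ => mul_nonneg (hX a₁ k) (hY k (jz a₁))).1 (hjz a₁)
      exact fun k => this k (Finset.mem_univ k)
    refine Finset.sum_eq_zero fun k _ => ?_
    by_cases hk : X a k = 0
    · rw [hk, zero_mul]
    · have hmem : k ∈ pat a := by simp [pat, hk]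
      rw [← hpat] at hmem
      have hk₁ : X a₁ k ≠ 0 := by simpa [pat] using hmem
      have hYk : Y k (jz a₁) = 0 := by
        rcases mul_eq_zero.1 (hrow₁ k) with h0 | h0
        · exact absurd h0 hk₁
        · exact h0
      rw [hYk, mul_zero]
  have key := three_pow_le_of_hits h v hv c d hvalid hone hdisj q' hq' hhit'
  simpa [Fintype.card_finset] using key

/-- **COR form of the two-matrix floor.**  `G = X·Y` is the clique-row GAP matrix of the passenger points `q j`
w.r.t. row maxima `m a` over `Q` (`udRow a · q j + G(a,j) = m a`), nonnegative with `s` terms and a zero in every row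
(a tight passenger vertex per row — automatic when `q` lists the vertices of a polytope `Q`).  Then
`3ⁿ ≤ 2^s · (r+1) · 2ⁿ` for every size-`r` EF of `COR(n) + Q`: the virtual budget `s = rank₊ G ≤ xc(Q) + 1` is priced at
support level exactly up to `s < n·log₂ 1.5`. -/
theorem corPolytope_add_three_pow_le_of_budget {n r s : ℕ} {J : Type} [Fintype J] {Q : Set (Fin (n * n) → ℝ)}
    (h : HasEFOfSize (corPolytope n + Q) r) (q : J → Fin (n * n) → ℝ) (hq : ∀ j, q j ∈ Q)
    (m : Finset (Fin n) → ℝ) (hm : ∀ a, ∀ y ∈ Q, udRow a ⬝ᵥ y ≤ m a)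
    (X : Finset (Fin n) → Fin s → ℝ) (Y : Fin s → J → ℝ) (hX : ∀ a k, 0 ≤ X a k) (hY : ∀ k j, 0 ≤ Y k j)
    (hG : ∀ a j, udRow a ⬝ᵥ q j + ∑ k, X a k * Y k j = m a) (hzero : ∀ a, ∃ j, ∑ k, X a k * Y k j = 0) :
    3 ^ n ≤ 2 ^ s * (r + 1) * 2 ^ n := by
  classical
  obtain ⟨pt_mem, cc_valid, slack, -⟩ := ud_data n
  have key := three_pow_le_of_budget h udPt pt_mem udRow (fun _ => 1) cc_valid ?_ ?_ q hq X Y hX hY hzero ?_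
  · simpa [Fintype.card_fin] using key
  · intro a b hlt hone
    have := slack a b
    rw [hone] at this
    norm_num at this
    linarith
  · intro a b hab
    have := slack a b
    rw [Finset.disjoint_iff_inter_eq_empty.1 hab, Finset.card_empty] at this
    norm_num at this
    linarith
  · intro a j hz y hy
    have := hG a j
    rw [hz, add_zero] at this
    rw [this]
    exact hm a y hy


/-! ## §7 The entanglement budget in COR currency, modulo ONE named value-level fact (rev 1.3; VERDICT #5 price P1)

The support-level facts in the tree (Kaibel–Weltge `1.5^h`, fooling sets) cannot price ENTANGLED lifts: after
`entangled_collapse` the collapsed matrix is only `2ρ`-CLOSE to the clique slack pattern, its zeros are gone.  What is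
needed is the VALUE-LEVEL (corruption) lower bound for unique disjointness.  We isolate it as ONE named fact in the
exact shape the argument consumes — Razborov's rectangle-corruption lemma in measure form — and prove the rest in the
kernel: `approxRank_of_corruption` (corruption ⇒ approximate nonnegative rank, via the tree's PROVED hyperplane
separation bound `Literature.Computability.Complexity.hyperplane_separation_bound`, Rothvoß 2017 Lemma 5) and
`entangled_budget` (= `entangled_collapse` + `approxRank_of_corruption`): for every lift of an EF of `P + Q` whose
clique-row slack pattern on `P` is UDISJ-like, entangled weight `ρ` per row and `r` lift coordinates satisfy
`(1 − 2ρ) − 2κρ ≤ r · (L₀ + 2ρ) · ε(h)`; with Razborov's `ε(h) = 2^{−c h}` this reads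
**`r ≥ 2^{c h} · (1 − 2ρ(1+κ)) / (L₀ + 2ρ)`, i.e. every EF of `COR(K_h) + Q` of size `2^{o(h)}` has entangled
weight `ρ ≥ 1/(2(1+κ)) − o(1)` in some clique row** — the typed form of «ENT ≥ 1/8» on the card.

NAMED FACT (PORT WANTED — statement shape proposed here for lit g17 / the port pool; not proved, used as a hypothesis):
`UDisjRectangleCorruptionAt h κ ε` := there are probability weights `μD` on pairs `(a,b)` of subsets of `[h]` with
`a ≠ ∅`, `a ∩ b = ∅` and `μU` on pairs with `|a ∩ b| = 1` such that every rectangle `A × B` has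
`μD(A × B) ≤ κ · μU(A × B) + ε`.  Print: A. A. Razborov, *On the distributional complexity of disjointness*,
Theoret. Comput. Sci. 106 (1992) 385–390, main Lemma (|a| = |b| = ⌈h/4⌉, `ε = 2^{−Ω(h)}`, `κ = O(1)`); the derived
nonnegative-rank forms are Braverman–Moitra 2013 and Braun–Pokutta 2013 Thm 4.1 / 4.4
[corpus: paper:doi-10-1109-focs-2013-79 p0011 L7, p0014 L24] (exact-pattern versions; the measure form below is the
one robust to the `2ρ` slack). -/

/-- NAMED FACT SHAPE (Razborov 1992 rectangle corruption for unique disjointness, measure form; PORT WANTED — used only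
as a hypothesis below). -/
def UDisjRectangleCorruptionAt (h : ℕ) (κ ε : ℝ) : Prop :=
  ∃ μD μU : Finset (Fin h) → Finset (Fin h) → ℝ,
    (∀ a b, 0 ≤ μD a b) ∧ (∀ a b, 0 ≤ μU a b) ∧
    (∀ a b, μD a b ≠ 0 → a.Nonempty ∧ Disjoint a b) ∧
    (∀ a b, μU a b ≠ 0 → (a ∩ b).card = 1) ∧
    (∑ a, ∑ b, μD a b = 1) ∧ (∑ a, ∑ b, μU a b = 1) ∧
    ∀ A B : Finset (Finset (Fin h)),
      ∑ a ∈ A, ∑ b ∈ B, μD a b ≤ κ * ∑ a ∈ A, ∑ b ∈ B, μU a b + ε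

/-- The asymptotic named fact (Razborov 1992, main lemma; Kushilevitz–Nisan Lemma 4.49): corruption `2^{-c h}` with a
fixed ratio `κ`, for all large `h` (`h ≥ h₀`: at `h = 0` there is no nonempty row, and the printed constants
`2^{-δh}/(α p₀)` are absorbed into a smaller `c` only eventually). PORT WANTED. -/
def UDisjRectangleCorruption : Prop :=
  ∃ κ c : ℝ, 0 ≤ κ ∧ 0 < c ∧ ∃ h₀ : ℕ, ∀ h ≥ h₀, UDisjRectangleCorruptionAt h κ ((2 : ℝ) ^ (-(c * h)))

open Literature.Computability.Complexity (hyperplane_separation_bound) in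
/-- **Corruption ⇒ approximate nonnegative rank** (kernel; the value-level replacement of the fooling-set bound).
If a nonnegative matrix `N = U · V` with `card W` inner terms is `≥ 1 − δ` on the nonempty-disjoint pairs, `≤ δ` on the
uniquely-intersecting pairs and `≤ L` everywhere, then `(1 − δ) − κ δ ≤ card W · L · ε`. -/
theorem approxRank_of_corruption {h : ℕ} {κ ε : ℝ} (hκ : 0 ≤ κ) (hfact : UDisjRectangleCorruptionAt h κ ε)
    {W : Type} [Fintype W] (U : Finset (Fin h) → W → ℝ) (V : W → Finset (Fin h) → ℝ)
    (hU : ∀ a w, 0 ≤ U a w) (hV : ∀ w b, 0 ≤ V w b) (δ L : ℝ) (hL : 0 ≤ L)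
    (hD : ∀ a b, a.Nonempty → Disjoint a b → 1 - δ ≤ ∑ w, U a w * V w b)
    (hUq : ∀ a b, (a ∩ b).card = 1 → ∑ w, U a w * V w b ≤ δ)
    (hNL : ∀ a b, ∑ w, U a w * V w b ≤ L) :
    (1 - δ) - κ * δ ≤ Fintype.card W * (L * ε) := by
  classical
  obtain ⟨μD, μU, hμD0, hμU0, hDsupp, hUsupp, hD1, hU1, hcorr⟩ := hfact
  set N : Finset (Fin h) → Finset (Fin h) → ℝ := fun a b => ∑ w, U a w * V w b with hN
  let e : W ≃ Fin (Fintype.card W) := Fintype.equivFin W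
  have hmain := hyperplane_separation_bound (X := Finset (Fin h)) (Y := Finset (Fin h))
    Finset.univ Finset.univ (fun a b => μD a b - κ * μU a b) N (∅ : Set _) ε L hL
    (by
      intro A _ B _ _
      have hc := hcorr A B
      have e1 : ∑ x ∈ A, ∑ y ∈ B, (μD x y - κ * μU x y) =
          ∑ x ∈ A, ∑ y ∈ B, μD x y - κ * ∑ x ∈ A, ∑ y ∈ B, μU x y := by
        rw [Finset.mul_sum, ← Finset.sum_sub_distrib]
        refine Finset.sum_congr rfl fun x _ => ?_
        rw [Finset.mul_sum, ← Finset.sum_sub_distrib]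
      rw [e1]; linarith)
    (by intro x _ y _ hz; exact absurd hz (Set.notMem_empty _))
    (fun a _ b _ => hNL a b)
    (fun a i => U a (e.symm i)) (fun b i => V (e.symm i) b)
    (fun a i => hU a _) (fun b i => hV _ b)
    (by
      intro a _ b _
      simp only [hN]
      exact (Equiv.sum_comp e.symm (fun w => U a w * V w b)).symm)
  -- lower-bound the left-hand side by `(1 - δ) - κ δ`
  have hlow : (1 - δ) - κ * δ ≤ ∑ a, ∑ b, (μD a b - κ * μU a b) * N a b := by
    have hDpart : ∀ a b, μD a b * (1 - δ) ≤ μD a b * N a b := by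
      intro a b
      by_cases h0 : μD a b = 0
      · simp [h0]
      · obtain ⟨hne, hdis⟩ := hDsupp a b h0
        exact mul_le_mul_of_nonneg_left (hD a b hne hdis) (hμD0 a b)
    have hUpart : ∀ a b, μU a b * N a b ≤ μU a b * δ := by
      intro a b
      by_cases h0 : μU a b = 0
      · simp [h0]
      · exact mul_le_mul_of_nonneg_left (hUq a b (hUsupp a b h0)) (hμU0 a b)
    have e2 : ∑ a, ∑ b, (μD a b - κ * μU a b) * N a b =
        ∑ a, ∑ b, μD a b * N a b - κ * ∑ a, ∑ b, μU a b * N a b := by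
      rw [Finset.mul_sum, ← Finset.sum_sub_distrib]
      refine Finset.sum_congr rfl fun a _ => ?_
      rw [Finset.mul_sum, ← Finset.sum_sub_distrib]
      refine Finset.sum_congr rfl fun b _ => ?_
      ring
    have h1 : (∑ a, ∑ b, μD a b) * (1 - δ) ≤ ∑ a, ∑ b, μD a b * N a b := by
      rw [Finset.sum_mul]
      exact Finset.sum_le_sum fun a _ => by
        rw [Finset.sum_mul]; exact Finset.sum_le_sum fun b _ => hDpart a b
    have h2 : ∑ a, ∑ b, μU a b * N a b ≤ (∑ a, ∑ b, μU a b) * δ := by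
      rw [Finset.sum_mul]
      exact Finset.sum_le_sum fun a _ => by
        rw [Finset.sum_mul]; exact Finset.sum_le_sum fun b _ => hUpart a b
    rw [hD1] at h1; rw [hU1] at h2
    rw [e2]
    nlinarith
  have hmain' : ∑ a, ∑ b, (μD a b - κ * μU a b) * N a b ≤ Fintype.card W * (L * ε) := by
    simpa using hmain
  exact hlow.trans hmain'

/-- **The entanglement budget** (kernel, modulo the named fact): in the setting of `entangled_collapse` — an EF of
`R = P + Q` with lift coordinates `W`, Farkas multipliers `U ≥ 0` of the clique-type rows, sections
`α_w(b) + β_w(j) + t_w(b,j)` whose entangled part has weight `∑_w U_{aw} ε_w ≤ ρ` in every row — if the `P`-slack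
pattern `F` of those rows is UDISJ-like (`1` on nonempty-disjoint pairs, `0` on uniquely-intersecting pairs, `≤ L₀`),
then `(1 − 2ρ) − 2κρ ≤ card W · (L₀ + 2ρ) · ε`.  With `UDisjRectangleCorruption` (`ε = 2^{-ch}`): an EF of
`COR(K_h) + Q` with `2^{o(h)}` lift coordinates must carry entangled weight `ρ ≥ 1/(2(1+κ)) − o(1)` in some row. -/
theorem entangled_budget {h : ℕ} {κ ε : ℝ} (hκ : 0 ≤ κ) (hfact : UDisjRectangleCorruptionAt h κ ε)
    {J W : Type} [Fintype W] [Fintype J] [Nonempty J]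
    (F : Finset (Fin h) → Finset (Fin h) → ℝ) (G : Finset (Fin h) → J → ℝ) (U : Finset (Fin h) → W → ℝ)
    (α : W → Finset (Fin h) → ℝ) (β : W → J → ℝ) (t : W → Finset (Fin h) → J → ℝ) (εw : W → ℝ) (ρ L₀ : ℝ)
    (hU : ∀ a w, 0 ≤ U a w) (hF0 : ∀ a, ∃ b, F a b = 0) (hG0 : ∀ a, ∃ j, G a j = 0)
    (hv : ∀ w b j, 0 ≤ α w b + β w j + t w b j) (ht : ∀ w b j, |t w b j| ≤ εw w)
    (hε : ∀ a, ∑ w, U a w * εw w ≤ ρ)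
    (hsum : ∀ a b j, ∑ w, U a w * (α w b + β w j + t w b j) = F a b + G a j)
    (hF1 : ∀ a b, a.Nonempty → Disjoint a b → F a b = 1) (hFu : ∀ a b, (a ∩ b).card = 1 → F a b = 0)
    (hFL : ∀ a b, F a b ≤ L₀) (hL₀ : 0 ≤ L₀) (hρ : 0 ≤ ρ) :
    (1 - 2 * ρ) - κ * (2 * ρ) ≤ Fintype.card W * ((L₀ + 2 * ρ) * ε) := by
  obtain ⟨V, hV, hclose⟩ := entangled_collapse F G U α β t εw ρ hU hF0 hG0 hv ht hε hsum
  refine approxRank_of_corruption hκ hfact U V hU hV (2 * ρ) (L₀ + 2 * ρ) (by positivity) ?_ ?_ ?_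
  · intro a b hne hdis
    have h1 := (abs_le.1 (hclose a b)).1
    rw [hF1 a b hne hdis] at h1
    linarith
  · intro a b hab
    have h1 := (abs_le.1 (hclose a b)).2
    rw [hFu a b hab] at h1
    linarith
  · intro a b
    have h1 := (abs_le.1 (hclose a b)).2
    have h2 := hFL a b
    linarith

end Summit.ValiantsHypothesis.ValiantsHypothesis.Cruxes.NNDivisionHard.EntangledLift
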